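import Mathlib
import HarnessLib
import Literature.NumberTheory.Automorphic.StrongArtinGL2
import Literature.NumberTheory.Automorphic.LanglandsTetrahedral
import Literature.NumberTheory.GaloisRepresentations.GaloisRep
import Literature.NumberTheory.GaloisRepresentations.ArtinRestriction
import Literature.RepresentationTheory.Semisimple.BurnsideMatrixSpan

/-!
# Even extensions lie OUTSIDE the odd base-change sector of R′ =
`ParityBlindBianchi.ArtinWeightRealisationLevel` (stmt-Langlands-15111) — helper file (`--supports`),
line `Sketch`, continuation lead c14

Companion of `…OddBaseChangeSector` (the odd base-change sector of the crux R′ closed modulo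
Khare–Wintenberger + Booker + Arthur–Clozel 4.2 (a) + JL).  That sector consists of the
`σ = ρ|_{Γ_K}` with `ρ : Γ_ℚ → GL₂(ℚ̄_p)` ODD of finite image.  This file records, kernel-checked,
that the route's own instance is NOT in it: if `ρ|_{Γ_K}` is irreducible and `ρ` is not odd (even at
some complex conjugation), then no odd `ρ'` restricts to the same `σ` — parity of an extension of
`σ` to `Γ_ℚ` is well defined.  Pure group theory (Schur's lemma through Burnside's theorem over the
algebraically closed `ℚ̄_p`, `Γ_K ⊲ Γ_ℚ` of index `2`, `c² = 1`); no named fact.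

* `exists_eq_scalar_mul_of_restrictField_eq` — two representations of `Γ_ℚ` agreeing on `Γ_K`,
  irreducible there, differ pointwise by scalars;
* `not_exists_isOdd_restrictField_eq_of_not_isOdd` — the registered stub: even (non-odd) `ρ` with
  `ρ|_{Γ_K}` irreducible admits no odd `ρ'` with `ρ'|_{Γ_K} = ρ|_{Γ_K}`; so the instance of R′
  consumed by `ParityBlindBianchi.closes` (`σ = ρ|_{Γ_K}`, `ρ` EVEN icosahedral) lies in the residual
  sector of `artinWeightRealisationLevel_of_residual_sector` (the open core: Calegari 2023 §12).
-/

noncomputable section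

open scoped BigOperators Topology Classical Matrix NumberField MatrixGroups
open Literature.NumberTheory.Automorphic Literature.NumberTheory.GaloisRepresentations
  IsDedekindDomain NumberField Filter

-- `Summit.Langlands.Langlands.…`: summit = sub-problem name (D-0017 nested layout), not a typo.
set_option linter.dupNamespace false

namespace Summit.Langlands.Langlands.Theorems.ArtinWeightRealisationLevel

/-- **Schur along an index-two restriction.**  Let `ρ ρ' : Γ_ℚ → GL₂(k)` (`k` algebraically
closed) agree on `Γ_K` for a quadratic field `K`, with `ρ|_{Γ_K}` irreducible.  Then for every
`g ∈ Γ_ℚ` the matrix `ρ(g)⁻¹ ρ'(g)` is scalar: it commutes with every `ρ(h)`, `h ∈ Γ_K` (as `Γ_K` is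
normal), and these span `M₂(k)` (Burnside). [folklore] -/
theorem exists_eq_scalar_mul_of_restrictField_eq {k : Type*} [Field k] [IsAlgClosed k]
    [TopologicalSpace k] [IsTopologicalRing k] (K : Type) [Field K] [NumberField K] (hK : Module.finrank ℚ K = 2)
    (ρ ρ' : FramedGaloisRep ℚ k 2) (hirr : (ρ.restrictField K).toGaloisRep.IsIrreducible)
    (heq : ρ'.restrictField K = ρ.restrictField K) (g : Field.absoluteGaloisGroup ℚ) :
    ∃ t : k, ((ρ' g : GL (Fin 2) k) : Matrix (Fin 2) (Fin 2) k) =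
      t • ((ρ g : GL (Fin 2) k) : Matrix (Fin 2) (Fin 2) k) := by
  haveI : FiniteDimensional ℚ K := Module.finite_of_finrank_eq_succ hK
  obtain ⟨-, hindex⟩ := isOpen_range_absGaloisRestrict_and_index ℚ K
  rw [hK] at hindex
  haveI hnormal : ((absGaloisRestrict ℚ K).range : Subgroup (Field.absoluteGaloisGroup ℚ)).Normal :=
    Subgroup.normal_of_index_eq_two hindex
  -- `M := ρ(g)⁻¹ ρ'(g)` commutes with every `ρ(h)`, `h ∈ Γ_K`
  set M : Matrix (Fin 2) (Fin 2) k :=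
    (((ρ g)⁻¹ : GL (Fin 2) k) : Matrix (Fin 2) (Fin 2) k) * ((ρ' g : GL (Fin 2) k) : Matrix (Fin 2) (Fin 2) k)
    with hM
  have hagree : ∀ h : Field.absoluteGaloisGroup K, ρ' (absGaloisRestrict ℚ K h) = ρ (absGaloisRestrict ℚ K h) := by
    intro h
    have := DFunLike.congr_fun heq h
    simpa only [FramedGaloisRep.restrictField_apply] using this
  have hcomm : ∀ h : Field.absoluteGaloisGroup K,
      M * ((ρ (absGaloisRestrict ℚ K h) : GL (Fin 2) k) : Matrix (Fin 2) (Fin 2) k) =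
        ((ρ (absGaloisRestrict ℚ K h) : GL (Fin 2) k) : Matrix (Fin 2) (Fin 2) k) * M := by
    intro h
    -- `g h g⁻¹ ∈ Γ_K`
    have hmem : g * absGaloisRestrict ℚ K h * g⁻¹ ∈
        ((absGaloisRestrict ℚ K).range : Subgroup (Field.absoluteGaloisGroup ℚ)) :=
      hnormal.conj_mem _ ⟨h, rfl⟩ g
    obtain ⟨h', hh'⟩ := hmem
    -- `ρ'(g) ρ(h) ρ'(g)⁻¹ = ρ'(g h g⁻¹) = ρ(g h g⁻¹) = ρ(g) ρ(h) ρ(g)⁻¹`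
    have e1 : ρ' g * ρ' (absGaloisRestrict ℚ K h) * (ρ' g)⁻¹ = ρ' (g * absGaloisRestrict ℚ K h * g⁻¹) := by
      rw [map_mul, map_mul, map_inv]
    have e2 : ρ g * ρ (absGaloisRestrict ℚ K h) * (ρ g)⁻¹ = ρ (g * absGaloisRestrict ℚ K h * g⁻¹) := by
      rw [map_mul, map_mul, map_inv]
    have e3 : ρ' (g * absGaloisRestrict ℚ K h * g⁻¹) = ρ (g * absGaloisRestrict ℚ K h * g⁻¹) := by
      have hh'' : (absGaloisRestrict ℚ K) h' = g * absGaloisRestrict ℚ K h * g⁻¹ := hh'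
      rw [← hh'']
      exact hagree h'
    have e4 : (ρ g)⁻¹ * ρ' g * ρ (absGaloisRestrict ℚ K h) = ρ (absGaloisRestrict ℚ K h) * ((ρ g)⁻¹ * ρ' g) := by
      have key : ρ' g * ρ' (absGaloisRestrict ℚ K h) * (ρ' g)⁻¹ = ρ g * ρ (absGaloisRestrict ℚ K h) * (ρ g)⁻¹ := by
        rw [e1, e3, ← e2]
      rw [hagree h] at key
      calc (ρ g)⁻¹ * ρ' g * ρ (absGaloisRestrict ℚ K h)
          = (ρ g)⁻¹ * (ρ' g * ρ (absGaloisRestrict ℚ K h) * (ρ' g)⁻¹) * ρ' g := by group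
        _ = (ρ g)⁻¹ * (ρ g * ρ (absGaloisRestrict ℚ K h) * (ρ g)⁻¹) * ρ' g := by rw [key]
        _ = ρ (absGaloisRestrict ℚ K h) * ((ρ g)⁻¹ * ρ' g) := by group
    have := congrArg (fun u : GL (Fin 2) k => (u : Matrix (Fin 2) (Fin 2) k)) e4
    simpa only [Units.val_mul, hM] using this
  -- Burnside: the `ρ(h)` span `M₂(k)`, so `M` commutes with everything, hence is scalar
  haveI : Representation.IsIrreducible
      ((glStdRepresentation (Fin 2) k).comp (ρ.restrictField K).toMonoidHom) := hirr
  have hspan := Literature.RepresentationTheory.Semisimple.span_eq_top_of_isIrreducible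
    (ρ.restrictField K).toMonoidHom
  have hcommAll : ∀ X : Matrix (Fin 2) (Fin 2) k, Commute X M := by
    intro X
    have hX : X ∈ Submodule.span k (Set.range fun h : Field.absoluteGaloisGroup K =>
        (((ρ.restrictField K).toMonoidHom h : GL (Fin 2) k) : Matrix (Fin 2) (Fin 2) k)) := by
      rw [hspan]; exact Submodule.mem_top
    refine Submodule.span_induction ?_ ?_ ?_ ?_ hX
    · rintro _ ⟨h, rfl⟩
      exact (hcomm h).symm
    · exact Commute.zero_left M
    · intro x y _ _ hx hy; exact hx.add_left hy
    · intro a x _ hx; exact hx.smul_left a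
  obtain ⟨t, ht⟩ := Matrix.mem_range_scalar_iff_commute_single'.2 fun i j => hcommAll _
  refine ⟨t, ?_⟩
  have hM' : ((ρ' g : GL (Fin 2) k) : Matrix (Fin 2) (Fin 2) k) =
      ((ρ g : GL (Fin 2) k) : Matrix (Fin 2) (Fin 2) k) * M := by
    rw [hM, ← Matrix.mul_assoc, ← Units.val_mul, mul_inv_cancel, Units.val_one, Matrix.one_mul]
  rw [hM', ← ht, Matrix.scalar_apply,
    show (Matrix.diagonal fun _ : Fin 2 => t) = t • (1 : Matrix (Fin 2) (Fin 2) k) from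
      (Matrix.smul_one_eq_diagonal t).symm, Matrix.mul_smul, Matrix.mul_one]


/-- **Even extensions lie outside the odd base-change sector.**  Let `K` be a quadratic field and
`ρ : Γ_ℚ → GL₂(ℚ̄_p)` with `ρ|_{Γ_K}` irreducible and NOT odd (so `det ρ(c) ≠ -1` at some complex
conjugation `c`).  Then no ODD `ρ' : Γ_ℚ → GL₂(ℚ̄_p)` has `ρ'|_{Γ_K} = ρ|_{Γ_K}`: by Schur
(`exists_eq_scalar_mul_of_restrictField_eq`) `ρ'(c) = t ρ(c)`, and `c² = 1`
(`IsComplexConjugation.sq_eq_one`) forces `t² = 1`, so `det ρ'(c) = t² det ρ(c) = det ρ(c) ≠ -1`.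
In particular the instance of R′ consumed by the route `ParityBlindBianchi` (`σ = ρ|_{Γ_K}` with `ρ`
EVEN icosahedral) is NOT in the sector closed by `artinWeightRealisationLevel_oddBaseChange_sector`:
it lies in the residual sector of `artinWeightRealisationLevel_of_residual_sector`. [folklore] -/
theorem not_exists_isOdd_restrictField_eq_of_not_isOdd : ∀ {p : ℕ} [Fact p.Prime] (K : Type) [Field K] [NumberField K], Module.finrank ℚ K = 2 → ∀ (ρ : Literature.NumberTheory.GaloisRepresentations.FramedGaloisRep ℚ (PadicAlgCl p) 2), (ρ.restrictField K).toGaloisRep.IsIrreducible → ¬ ρ.IsOdd → ¬ ∃ ρ' : Literature.NumberTheory.GaloisRepresentations.FramedGaloisRep ℚ (PadicAlgCl p) 2, Finite ρ'.toMonoidHom.range ∧ ρ'.IsOdd ∧ ρ'.restrictField K = ρ.restrictField K := by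
  intro p _ K _ _ hK ρ hirr heven
  unfold FramedGaloisRep.IsOdd at heven
  push Not at heven
  obtain ⟨φ, c, hc, hdet⟩ := heven
  rintro ⟨ρ', -, hodd', heq⟩
  have h1 : Matrix.GeneralLinearGroup.det (ρ' c) = -1 := hodd' φ c hc
  obtain ⟨t, ht⟩ := exists_eq_scalar_mul_of_restrictField_eq K hK ρ ρ' hirr heq c
  -- `c² = 1`, so `ρ(c)² = 1 = ρ'(c)²` and `t² = 1`
  have hcc : c * c = 1 := by rw [← pow_two]; exact hc.sq_eq_one
  have hA : ((ρ c : GL (Fin 2) (PadicAlgCl p)) : Matrix (Fin 2) (Fin 2) (PadicAlgCl p)) *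
      ((ρ c : GL (Fin 2) (PadicAlgCl p)) : Matrix (Fin 2) (Fin 2) (PadicAlgCl p)) = 1 := by
    rw [← Units.val_mul, ← map_mul, hcc, map_one, Units.val_one]
  have hA' : ((ρ' c : GL (Fin 2) (PadicAlgCl p)) : Matrix (Fin 2) (Fin 2) (PadicAlgCl p)) *
      ((ρ' c : GL (Fin 2) (PadicAlgCl p)) : Matrix (Fin 2) (Fin 2) (PadicAlgCl p)) = 1 := by
    rw [← Units.val_mul, ← map_mul, hcc, map_one, Units.val_one]
  have htt : t * t = 1 := by
    rw [ht, Matrix.smul_mul, Matrix.mul_smul, hA, smul_smul] at hA'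
    have h00 := congrFun (congrFun hA' 0) 0
    simpa using h00
  -- determinants: `det ρ'(c) = t² det ρ(c) = det ρ(c)`
  have hdet' : ((Matrix.GeneralLinearGroup.det (ρ' c) : (PadicAlgCl p)ˣ) : PadicAlgCl p) =
      ((Matrix.GeneralLinearGroup.det (ρ c) : (PadicAlgCl p)ˣ) : PadicAlgCl p) := by
    rw [Matrix.GeneralLinearGroup.val_det_apply, Matrix.GeneralLinearGroup.val_det_apply, ht,
      Matrix.det_smul, Fintype.card_fin, pow_two, htt, one_mul]
  apply hdet
  rw [← Units.val_inj, ← hdet', h1]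

end Summit.Langlands.Langlands.Theorems.ArtinWeightRealisationLevel

end
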